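import Summits.AnomalousDissipation.AnomalousDissipation.Theorems.DenseLoudDesignerForces.Negative.StockEnlargement
import Summits.AnomalousDissipation.AnomalousDissipation.Theorems.DenseLoudDesignerForces.Negative.Planar
import Summits.AnomalousDissipation.AnomalousDissipation.Theorems.DenseLoudDesignerForces.Negative.BeltramiPalinstrophy
import Summits.AnomalousDissipation.AnomalousDissipation.Theorems.DenseLoudDesignerForces.Negative.FluxCapacity
import Literature.Analysis.FluidPDE.AlexakisDoeringProofs
import Literature.Analysis.FluidPDE.NSEnstrophyBalance2DProofs
import Literature.Analysis.FunctionSpaces.TorusSpaceTimeFields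

/-!
# Disproof work file for the crux `DenseLoudDesignerForces` (stmt-AnomalousDissipation-1143)

Standing adversary (cdisprove, generations 2–3) on the rank-2 crux of route `BaireTransfer`.
Prose lives in docstrings only.  LAYOUT (v15b, 2026-08-16): §0–§11 (generation 2) are LANDED as certified files
`Summits/AnomalousDissipation/AnomalousDissipation/Theorems/DenseLoudDesignerForces/Negative/`
`{KillShape, PowerBudget, MomentumBudget, WindowBounds, FalseWithoutConvection, WitnessAnatomy, BandLimited,
Scaling, StockEnlargement}.lean` (namespace `…Theorems.DenseLoudDesignerForces.Negative`, gate-accepted, importable)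
and are IMPORTED here rather than repeated (the work file exceeded the 200 kB publication limit), and so are the
LANDED generation-3 sections §12 (`Negative/Planar.lean`, p71844), §13–§14 (`Negative/BeltramiPalinstrophy.lean`,
p72002), §15 (`Negative/FourierSlices.lean` p72806, `Negative/ConstantFlux.lean` p73684) and §16
(`Negative/FluxCapacity.lean` p73853); every name quoted in the index below for those sections is a declaration of
that namespace.  §17 is carried verbatim below (its certified copy `Negative/PeriodFloor.lean` p74430 has landed; the import
replaces this copy at the next update) together with the window corollary §18 and the VERDICT block.  FINDINGS INDEX (kept current):

* §0 `loudSet`, `force`, `IsWindow`, `denseLoudDesignerForces_iff` — the crux unfolded (by `Iff.rfl`).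
* §1 `not_denseLoudDesignerForces_iff` — EXACT SHAPE OF A KILL (Baire–Osgood form = K1 of the route): some
  stock `S₀` such that for all `S ⊇ S₀`, all budgets and every open `U ≠ ∅` some level has an open `V ⊆ U`
  disjoint from `LOUD_j`.  A refutation is a UNIFORM local-quietness theorem; nothing less.
* §2 `loudSet_antitone`, `loudSet_mono_budgets`, `isWindow_of_eventually` — only small `ν` matters.
* §3 POWER BUDGET `meanDissipation_sq_le`: `⟨ν‖∇u‖²⟩² ≤ (∫‖F‖²)·⟨‖u‖²⟩` for every periodic classical orbit
  with steady force (energy equality over a period + AM–GM); `meanDissipation_eq_meanPower`.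
* §4 SHELLS: `∫‖f_c‖² ≤ ∑‖c k‖²`; `LOUD_j ⊆ {ε² ≤ #S‖c‖²E}` (closed); `0 ∉ closure LOUD_j`; `LOUD = ∅` for
  `S ⊆ {0}`; a window forces `E > 0`.  REFUTED STRENGTHENINGS: AtRest (`0 ∈ U`), Everywhere (`U = P_S`),
  SameStock (`S = S₀`, fails at `S₀ = ∅, {0}`).
* §5 MOMENTUM BUDGET `momentum_period_identity` (exact RANS balance against any steady smooth solenoidal
  `φ`: `τ∫⟪F,φ⟫ = -∫₀^τ∫⟪u,(u·∇)φ⟫ - ν∫₀^τ∫⟪u,Δφ⟫`) and `abs_integral_inner_force_le`: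
  `|∫⟪F,φ⟫| ≤ ‖Dφ‖_∞⟨‖u‖²⟩ + (ν/2)(⟨‖u‖²⟩ + ∫‖Δφ‖²)`.
* §6 CONSEQUENCES: on `LOUD_j`, `|∫⟪f_c,φ⟫| ≤ ‖Dφ‖_∞E + (E+∫‖Δφ‖²)/(2(j+1))`; on a WINDOW (all levels,
  continuity in `c`): `|∫⟪f_c,φ⟫| ≤ ‖Dφ‖_∞E` for every test field, `∫‖f_c‖² ≤ Λ(c)E` with the gradient
  bound `Λ(c) = 2π∑ᵢ∑_k|kᵢ|‖c k‖ ≥ ‖Df_c‖_∞`, and the HEADLINE `ε² ≤ Λ(c)E² ≤ Λ₁(S)‖c‖E²`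
  (`sq_le_gradBound_mul_sq_of_window`, `sq_le_explicit_of_window`).  Reading: a window's forces are
  O(E·|k|) in every direction and its dissipation floor is O(E√(|k|‖c‖)) — the prover must take `E` large
  and `ε` small relative to `U`; no contradiction, these are the K41-compatible scalings `F ~ U²/ℓ`,
  `ε ~ U³/ℓ` read backwards.

* §7 LOAD-BEARING HYPOTHESIS — THE CONVECTIVE TERM: `denseLoudDesignerForces_false_without_convection`:
  with linear STOKES witnesses (the crux verbatim, `(u·∇)u` deleted) the statement is FALSE for every
  stock/budget/window.  Mechanism: Stokes self-pairing `∫‖f_c‖² ≤ (ν/2)(E + ‖Δf_c‖²_∞)` (the force a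
  bounded-energy linear periodic orbit can carry vanishes with `ν`) + power budget ⇒
  `ε² ≤ E(E + Λ₂(c)²)/(2(j+1))` on `sLOUD_j` (`stokes_shell`).  HENCE any proof of the crux must produce an
  O(1) mean Reynolds stress `τ⁻¹∫₀^τ∫⟪u,(u·∇)f_c⟫` against the force at bounded energy as `ν → 0`
  (compare `momentum_period_identity`): the loudness is carried entirely by the trilinear term.

* §8 WITNESS ANATOMY (quantitative targets for constructions): enstrophy floor `τ⁻¹∫₀^τ‖∇u‖² ≥ ε/ν > ε(j+1)`,
  power floor `τ⁻¹∫∫⟪f_c,u⟫ ≥ ε`, exact force-mass identity `∫‖f_c‖² = R - ντ⁻¹∫∫⟪u,Δf_c⟫` with the mean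
  REYNOLDS WORK `R = -τ⁻¹∫₀^τ∫⟪u,(u·∇)f_c⟫`, and the floor `R ≥ ε²/E - (ν/2)(E + Λ₂(c)²)`
  (`reynoldsWork_ge`, `exists_reynoldsWork_ge_of_mem_loudSet`): at small `ν` the whole `L²` mass of the
  force must be sustained by the orbit's triple correlation with the explicit low-mode strain `Df_c`.
* §9 REFUTED STRENGTHENING (BandLimited): Bernstein `‖∇v‖² ≤ 4π²Λ‖v‖²` for fields spectrally supported in
  `|k|² ≤ Λ` ⇒ `meanDissipation ≤ 4π²ΛνE` ⇒ `bandLOUD_j = ∅` once `4π²ΛE ≤ ε(j+1)` (`bandLoudSet_eq_empty`,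
  `not_window_bandLimited`): finite-mode / generalised-Beltrami / exact-Galerkin witness families are dead;
  the spectral support of loud witnesses must escape every finite band as `j → ∞`.

* §10 SCALE COVARIANCE / GRASHOF FORM: `timeRescale` (parabolic scaling of global classical orbits),
  `meanEnergy ↦ λ²`, `meanDissipation ↦ λ³`, `force S (a • c) = a • force S c`, `loudAt_iff_timeRescale`, and
  `mem_loudSet_iff_unit_viscosity`: `c ∈ LOUD_j` iff some `ν < 1/(j+1)` makes `ν⁻²c` loud AT VISCOSITY ONE with
  budgets `(E/ν², ε/ν³)` — the crux is the persistence of a positive dissipation coefficient `β = ε/U³` along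
  periodic orbits as the Grashof number `G ~ ‖c‖/ν² → ∞`, in a dense set of force directions; and rescaling a
  single moderate-`ν` loud orbit down the levels kills its dissipation floor (`ε ↦ λ³ε`), so symmetry gives
  nothing for free.

* §11 STOCK ENLARGEMENT: `force_extendCoeff` (`f_{ι c} = f_c` for the zero extension `ι : P_S → P_{S'}`,
  `S ⊆ S'`), `mem_loudSet_extend_iff` (loud sets are compatible) and `not_subset_range_extendCoeff` (the range
  of `ι` contains no non-empty open set once `S ⊊ S'`): windows do NOT push forward — the crux's hedge
  `∀ S₀ ∃ S ⊇ S₀` is genuinely stronger than `∃ S` and asks loudness to survive switching on the new modes.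

* §12 (generation 3) REFUTED STRENGTHENING / DIMENSIONAL LOAD — THE PLANAR ANALOGUE IS FALSE:
  `denseLoudDesignerForces_false_planar : ¬ DenseLoudDesignerForcesPlanar` (the crux verbatim on `T²`).  Via the
  tree's discharged Alexakis–Doering chain (`fmrt_enstrophy_balance_torus2_holds`,
  `meanEnstrophyDissipation_le_of_enstrophyBalance`, `meanDissipation_sq_le_of_enstrophyBalance`): every planar
  periodic classical orbit obeys `ε² ≤ ν Λ₂(c) U³` (`Planar.meanDissipation_sq_le_alexakisDoering`), whence the
  PLANAR SHELL `ε² ≤ Λ₂(c)E√E/(j+1)` (`Planar.planar_shell`) and emptiness of `pLOUD_j ∩ B` for bounded `B` at large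
  `j`.  Any proof of the crux must use VORTEX STRETCHING: the enstrophy floor `⟨‖∇u‖²⟩ ≥ ε/ν` (§8) is
  unreachable when the enstrophy budget closes.
* §13 (generation 3) REFUTED STRENGTHENING — GENERALISED-BELTRAMI WITNESSES ARE UNIFORMLY QUIET: if
  `(u·∇)u = ∇q(t)` (Beltrami/Trkalian `curl u ∥ u`, parallel/unidirectional shear, every flow with irrotational
  Lamb vector) then `(u, p+q)` is a Stokes orbit (`isClassicalStokesSolutionOn_of_convect_eq_gradient`), so §7 gives
  `ε² ≤ E(E+Λ₂(c)²)/(2(j+1))` (`beltrami_shell`), `not_window_beltrami`, `denseLoudDesignerForces_false_beltrami`;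
  also the window-level Stokes kill for ANY stock (`not_window_stokes`).  The solenoidal Lamb vector `P(ω × u)` of a
  loud orbit must do O(1) work on `f_c` (cf. the Reynolds-work floor of §8).
* §14 (generation 3) WITNESS ANATOMY II — PALINSTROPHY / VISCOUS-FORCE FLOOR: `(τ⁻¹∫‖∇u‖²)² ≤ ⟨‖u‖²⟩·τ⁻¹∫‖Δu‖²`
  (`mean_gradNormSq_sq_le`) + enstrophy floor ⇒ `τ⁻¹∫₀^τ‖Δu‖₂² ≥ ε²/(ν²E)` (`mean_laplacianNormSq_ge`) and
  `τ⁻¹∫₀^τ∫‖νΔu‖² ≥ ε²/E` (`mean_viscousForce_sq_ge`, `exists_palinstrophy_ge_of_mem_loudSet`): the viscous force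
  of a loud orbit is O(1) in mean-square `L²` at every level (K41: `ε^{3/2}ν^{-1/2}`), carried by wavenumbers `→ ∞`
  (§9) while `f_c` stays band-limited and O(E|k|) (§6) — the solenoidal acceleration `P(∂ₜu + (u·∇)u) = νΔu + f_c`
  is O(1) in `L²` at arbitrarily fine scales.
* §15 (generation 3) WITNESS ANATOMY III — THE CONSTANT-FLUX LAW: with `Π_N(t) = ∫⟪(u·∇)u, P_N u⟫` the energy flux out
  of the Fourier ball `|k| ≤ N` (`flux`; `P_N = Torus.fourierTruncate N`), every periodic classical orbit forced by `f_c`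
  with `S ⊆ B_N` satisfies `τ⁻¹∫₀^τ Π_N = ⟨ν‖∇u‖²⟩ - ν τ⁻¹∫₀^τ G_N` (`mean_flux_eq`; low-mode energy balance
  `integral_inner_timeDeriv_fourierTruncate`, time-differentiability of Fourier coefficients `hasDerivAt_mFourierCoeff`,
  band-limitedness `mFourierCoeff_force_eq_zero`), whence `⟨ν‖∇u‖²⟩ - 4π²N²ν⟨‖u‖²⟩ ≤ τ⁻¹∫Π_N ≤ ⟨ν‖∇u‖²⟩` and on the
  loud set `ε - 4π²N²E/(j+1) ≤ τ⁻¹∫Π_N` for EVERY `N ≥ deg S` (`exists_constantFlux_of_mem_loudSet`): loud orbits carry a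
  constant mean energy flux `ε` through an inertial range widening without bound — the cascade must be complete.
* §16 (generation 3) WITNESS ANATOMY IV — FLUX CAPACITY / FORCE-FREE CEILING: `|Π_N(t)| ≤ 6πN√(#B_N)√(E_N(t))‖u(t)‖₂²`
  (`abs_flux_le`: the flux is Reynolds stress against LOW-PASS strain, `‖D(P_N u)‖_∞ ≤ 6πN√(#B_N)√E_N`), hence for
  every periodic orbit forced in the band `S ⊆ B_N`: `⟨ν‖∇u‖²⟩ ≤ 6πN√(#B_N) τ⁻¹∫√(E_N)‖u‖₂² + 4π²N²ν⟨‖u‖²⟩`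
  (`meanDissipation_le_capacity` — the force AMPLITUDE does not appear: periodic-orbit Doering–Foias ceiling), and on
  the loud set `ε - 4π²N²E/(j+1) ≤ 6πN√(#B_N) τ⁻¹∫√(E_N)‖u‖₂²` (`capacity_floor_of_loud`, `capacity_le_cubic`): the
  low-pass amplitude weighted by the energy (a fortiori `⟨‖u‖₂³⟩`) has a force-free floor.
* §17 (generation 3) WITNESS ANATOMY V — ENERGY EXCURSIONS AND A PERIOD FLOOR: `½‖u(t)‖² ≤ ½‖u(s)‖² +
  ‖F‖₂((t-s)∫_s^t‖u‖²)^{1/2}` (`kineticEnergy_le_of_le`), `sup_t∫‖u(t)‖² ≤ ⟨‖u‖²⟩ + 2τ‖F‖₂⟨‖u‖²⟩^{1/2}`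
  (`energy_le_of_periodic`), hence with §16 `ε - 4π²N²E/(j+1) ≤ 6πN√(#B_N)·W√W`, `W = E + 2τ‖f_c‖₂√E`
  (`period_floor_of_loud`): loudness at small energy budget needs a LONG PERIOD (τ ≳ ((ε/6πN√#B_N)^{2/3} - E)/(2‖f_c‖₂√E)).
* §18 (generation 3) PERIOD FLOOR ON A WINDOW (`period_floor_on_window`): with §6 (`∫‖f_c‖² ≤ Λ(c)E` on windows) the §17
  bound becomes `ε - 4π²N²E/(j+1) ≤ 6πN√(#B_N)·W√W`, `W = E(1 + 2τ√Λ(c))` — low-energy windows are served only by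
  long-period orbits, uniformly over bounded `U`.

VERDICT SO FAR: no kill.  ¬crux is a uniform-quietness theorem for fixed-degree steady forcing at
small viscosity with bounded energy — the negation of the zeroth law on that force class restricted to
time-periodic classical witnesses (open).  No formal loophole: for classical periodic witnesses the
`limsup`/`toReal` junk of `meanEnergy`/`meanDissipation` is unreachable (period means,
`meanEnergy_eq_of_periodic`, `meanDissipation_eq_of_periodic`); the force `f_c` is smooth, solenoidal and
mean-free for every `c`; `IsClassicalNSSolutionOn univ` pins `u, p` jointly smooth on `ℝ × T³`.
WHY IT RESISTS: every inequality available for ALL periodic classical orbits (energy, momentum/RANS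
pairings) is linear or quadratic in `u` and closes only against the budgets `E`, `ε`, which the prover
chooses AFTER `U`; a kill needs an a-priori bound on `⟨f_c, u⟩` (the injected power) that tends to zero
as `ν → 0` at fixed energy — i.e. decorrelation of the forced modes of every bounded periodic orbit from the
force, which is the open core of the zeroth law.
PRINTED CONSTRAINTS NOT (YET) FORMALISED HERE (guidance for constructions): by the Onsager singularity theorem
for Leray solutions (Drivas–Eyink 2019, Lemma 1; tree: `DrivasEyink2019_noAnomalousDissipation` in
`Literature/Barriers/AnomalousDissipation/OnsagerSingularityLerayProofs`) a loud witness family `u_j` (levels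
`j → ∞`, one fixed time window after a time translation) cannot stay bounded in `L³_t B^σ_{3,∞}`, `σ > 1/3`:
loud designer orbits must develop Onsager-critical roughness, uniformly in nothing better than `B^{1/3}_{3,∞}`.
By §9 they cannot even stay in a fixed Fourier band; by §7 their loudness is carried by the triple correlation
with `Df_c`; by §10 the statement is the `G → ∞` persistence of `β = ε/U³ > 0` along periodic orbits; by §12 the
mechanism must be genuinely three-dimensional (vortex stretching), the planar analogue being certified false.
LITERATURE DILIGENCE: generation 2 was search-degraded (rc 75 throughout); generation 3 (2026-08-16; OpenAlex /
Crossref reachable, local searchd and S2 degraded): POSITIVE-SIDE EVIDENCE for the witness class — unstable periodic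
orbits reproducing the turbulent dissipation rate under steady low-mode forcing: van Veen–Kida–Kawahara 2006
(doi:10.1016/j.fluiddyn.2005.09.001, arXiv:1804.00547), Kawahara–Kida–van Veen 2006 (doi:10.5194/npg-13-499-2006),
and a periodic orbit WITH A K41 INERTIAL RANGE in LES of box turbulence, van Veen–Vela-Martín–Kawahara, PRL 123,
134502 (2019) (doi:10.1103/physrevlett.123.134502; cf. J. Phys. Conf. Ser. 1001, 012018) — exactly the crux's
witnesses modulo the LES closure (the constant-flux law of §15 is their defining property); Page–Kerswell 2020
(doi:10.1017/jfm.2019.1074).  NEGATIVE SIDE: De Rosa–Park 2024 "No anomalous dissipation in two-dimensional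
incompressible fluids" (arXiv:2403.04668; consistent with §12); Burczak–Székelyhidi–Wu 2023 (arXiv:2310.02934) concerns
SCALAR anomalous dissipation for Euler flows, not the energy of forced NS; no printed result bounds the dissipation of
time-periodic 3-D Navier–Stokes orbits under a fixed smooth force uniformly in `ν` — the kill statement of §1 remains an
open problem.  The negatives index (`ledger negatives --problem AnomalousDissipation`) and the barrier catalogue
(Marchioro / gravest-mode laminar attraction: 2-D or first-shell only; Cheskidov2023 Thm 1.3 blocks force-ROBUST negative
proofs — consistent with §1: a kill must use the fixed degree / steadiness of `f_c`; AlexakisDoering2006 = §12) were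
re-checked.

CONSTRUCTION TARGET SHEET (every witness `(ν, τ, u, p)` of a point `c ∈ LOUD_j(S,E,ε)`, `S ⊆ B_N`, must satisfy ALL of):
`⟨ν‖∇u‖²⟩ = τ⁻¹∫∫⟪f_c,u⟫ ≥ ε` (power, §3/§8) · `ε² ≤ ∫‖f_c‖²·E` (§4) · `τ⁻¹∫‖∇u‖² ≥ ε/ν > ε(j+1)` (§8) ·
`R = -τ⁻¹∫∫⟪u,(u·∇)f_c⟫ ≥ ε²/E - O(1/j)` (§8) · spectral support escapes every band (§9) · `τ⁻¹∫‖Δu‖² ≥ ε²/(ν²E)`,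
`τ⁻¹∫∫‖νΔu‖² ≥ ε²/E` (§14) · mean flux `τ⁻¹∫Π_M ∈ [ε - 4π²M²E/(j+1), ⟨ν‖∇u‖²⟩]` for every `M ≥ N` (§15) ·
`6πM√(#B_M) τ⁻¹∫√(E_M)‖u‖₂² ≥ ε - 4π²M²E/(j+1)` (§16) · `6πM√(#B_M) W√W ≥ ε - 4π²M²E/(j+1)`,
`W = E + 2τ‖f_c‖₂√E` (period floor, §17) · `sup_t ∫‖u(t)‖² ≤ E + 2τ‖f_c‖₂√E` (§17) · genuinely nonlinear (§7), rotational Lamb vector (§13),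
genuinely three-dimensional (§12), not band-limited (§9); and on a WINDOW: `|∫⟪f_c,φ⟫| ≤ ‖Dφ‖_∞E` for all solenoidal
`φ`, `ε² ≤ Λ(c)E²` (§6).
-/

noncomputable section

set_option linter.dupNamespace false

namespace Summit.AnomalousDissipation.AnomalousDissipation.Cruxes.DenseLoudDesignerForces.Disproof

open scoped BigOperators Topology ENNReal InnerProductSpace
open Filter Set MeasureTheory UnitAddTorus
open Literature.Analysis.FunctionSpaces Literature.Analysis.FluidPDE
open Summit.AnomalousDissipation.AnomalousDissipation.Theses.BaireTransfer
-- §0–§11: the certified generation-2 sections (designer force `force`, loud sets `loudSet`, kill shape, power and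
-- momentum budgets, window bounds, Stokes kill, witness anatomy, Bernstein, scaling, stock enlargement)
open Summit.AnomalousDissipation.AnomalousDissipation.Theorems.DenseLoudDesignerForces.Negative

/-- The flat unit 3-torus. -/
local notation "𝕋³" => UnitAddTorus (Fin 3)
/-- Velocity values. -/
local notation "E³" => EuclideanSpace ℝ (Fin 3)
/-- Complex Fourier coefficient values. -/
local notation "ℂ³" => EuclideanSpace ℂ (Fin 3)

/-! ## §0–§11 (generation 2), §12–§16 (generation 3): see the imported certified files
## `Theorems/DenseLoudDesignerForces/Negative/*.lean`

The statements are indexed in the module docblock above; e.g. `not_denseLoudDesignerForces_iff` (kill shape),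
`meanDissipation_sq_le` (power budget), `momentum_period_identity`, `sq_le_gradBound_mul_sq_of_window` (window
headline), `denseLoudDesignerForces_false_without_convection` (Stokes kill), `reynoldsWork_ge`,
`bandLoudSet_eq_empty`, `mem_loudSet_iff_unit_viscosity`, `not_subset_range_extendCoeff`;
`denseLoudDesignerForces_false_planar` (§12), `denseLoudDesignerForces_false_beltrami`, `not_window_stokes`,
`mean_laplacianNormSq_ge`, `mean_viscousForce_sq_ge` (§13–§14), `hasDerivAt_mFourierCoeff`, `lowEnergy`, `flux`,
`hasDerivAt_lowEnergy`, `integral_inner_laplacian_fourierTruncate`, `integral_inner_timeDeriv_fourierTruncate`,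
`mean_flux_eq`, `mean_flux_ge_of_loud`, `exists_constantFlux_of_mem_loudSet` (§15), `abs_flux_le`,
`meanDissipation_le_capacity`, `capacity_floor_of_loud` (§16). -/

/-- Sanity re-export (§12): the planar analogue of the crux is false. -/
theorem planar_analogue_false : ¬ DenseLoudDesignerForcesPlanar := denseLoudDesignerForces_false_planar

/-- Sanity re-export (§13): the generalised-Beltrami strengthening of the crux is false. -/
theorem beltrami_strengthening_false : ¬ DenseLoudDesignerForcesBeltrami := denseLoudDesignerForces_false_beltrami

/-- Sanity re-export (§15): the constant-flux law on the loud set. -/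
theorem constantFlux_of_mem_loudSet {S : Finset (Fin 3 → ℤ)} {E ε : ℝ} {c : ↥S → ℂ³} {j : ℕ} (hc : c ∈ loudSet S E ε j) :
    ∃ (ν τ : ℝ) (u : ℝ → 𝕋³ → E³) (p : ℝ → 𝕋³ → ℝ), 0 < ν ∧ ν < 1 / ((j : ℝ) + 1) ∧ 0 < τ ∧
      Torus.IsClassicalNSSolutionOn univ ν (fun _ => force S c) u p ∧ Function.Periodic u τ ∧
      ε ≤ meanDissipation ν u ∧
      ∀ N : ℕ, S ⊆ Torus.freqBall N →
        ε - 4 * Real.pi ^ 2 * (N : ℝ) ^ 2 * E / ((j : ℝ) + 1) ≤ τ⁻¹ * ∫ t in (0 : ℝ)..τ, flux N u t ∧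
        τ⁻¹ * ∫ t in (0 : ℝ)..τ, flux N u t ≤ meanDissipation ν u :=
  exists_constantFlux_of_mem_loudSet hc

/-- Sanity re-export: the kill shape of §1 is available here under the work-file namespace. -/
theorem not_crux_iff_killShape :
    ¬ DenseLoudDesignerForces ↔
      ∃ S₀ : Finset (Fin 3 → ℤ), ∀ S : Finset (Fin 3 → ℤ), S₀ ⊆ S → ∀ (E ε : ℝ), 0 < ε →
        ∀ U : Set (↥S → ℂ³), IsOpen U → U.Nonempty →
          ∃ j : ℕ, ∃ V : Set (↥S → ℂ³), IsOpen V ∧ V.Nonempty ∧ V ⊆ U ∧ Disjoint V (loudSet S E ε j) :=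
  not_denseLoudDesignerForces_iff

/-! ## §17 Witness anatomy V: energy excursions and a PERIOD FLOOR for low-energy loud orbits

For a classical orbit with steady force the energy can rise above its period mean only as fast as the force pumps it:
`½‖u(t)‖² ≤ ½‖u(s)‖² + ‖F‖₂ ((t-s)∫_s^t‖u‖₂²)^{1/2}` (`kineticEnergy_le_of_le`), so over a period
`sup_t ∫‖u(t)‖² ≤ ⟨‖u‖²⟩ + 2τ‖F‖₂⟨‖u‖²⟩^{1/2}` (`energy_le_of_periodic`: start from a time where the energy is below
its mean).  With the capacity floor of §16 this gives a PERIOD FLOOR (`period_floor_of_loud`):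
`ε - 4π²N²E/(j+1) ≤ 6πN√(#B_N) · (E + 2τ‖f_c‖₂√E)^{3/2}` — a loud orbit whose energy budget `E` is small compared with
`(ε/(N√#B_N))^{2/3}` must have a LONG PERIOD, `τ ≳ ((ε/(6πN√#B_N))^{2/3} - E)/(2‖f_c‖₂√E)`: intermittent loudness
(rare energetic bursts) costs period length linearly. -/

section Period

variable {S : Finset (Fin 3 → ℤ)} {ν τ : ℝ} {F : 𝕋³ → E³} {c : ↥S → ℂ³} {u : ℝ → 𝕋³ → E³} {p : ℝ → 𝕋³ → ℝ}

/-- ENERGY EXCURSION BOUND: `½‖u(t)‖² ≤ ½‖u(s)‖² + √(∫‖F‖²) · √((t-s) ∫_s^t ‖u‖₂²)` for `s ≤ t` (`ν ≥ 0`). -/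
theorem kineticEnergy_le_of_le (h : Torus.IsClassicalNSSolutionOn univ ν (fun _ => F) u p) (hν : 0 ≤ ν)
    {s t : ℝ} (hst : s ≤ t) :
    Torus.kineticEnergy (u t) ≤ Torus.kineticEnergy (u s) +
      Real.sqrt (∫ x, ‖F x‖ ^ 2) * Real.sqrt ((t - s) * ∫ r in s..t, ∫ x, ‖u r x‖ ^ 2) := by
  have hu := h.smooth_velocity
  have hF : Torus.IsSmooth F := isSmooth_of_solution h
  have hE := h.energy_eq convex_univ hst (subset_univ _)
  have hG : 0 ≤ ν * ∫ r in s..t, Torus.gradNormSq (u r) :=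
    mul_nonneg hν (intervalIntegral.integral_nonneg hst fun r _ => Torus.gradNormSq_nonneg _)
  set D : ℝ := ∫ r in s..t, ∫ x, ⟪F x, u r x⟫_ℝ with hDdef
  set A : ℝ := ∫ x, ‖F x‖ ^ 2 with hAdef
  set B : ℝ := ∫ r in s..t, ∫ x, ‖u r x‖ ^ 2 with hBdef
  have hA : 0 ≤ A := integral_nonneg fun _ => sq_nonneg _
  have hB : 0 ≤ B := intervalIntegral.integral_nonneg hst fun r _ => integral_nonneg fun _ => sq_nonneg _
  have hKE : Torus.kineticEnergy (u t) ≤ Torus.kineticEnergy (u s) + D := by linarith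
  have he_st : Torus.IsSmoothSpaceTimeOn univ (fun r x => ‖u r x‖ ^ 2) := by
    change ContDiffOn ℝ _ (fun z => ‖Torus.stLift u z‖ ^ 2) _
    exact hu.norm_sq ℝ
  have he_cont : Continuous fun r => ∫ x, ‖u r x‖ ^ 2 :=
    continuousOn_univ.1 (he_st.continuousOn_integral convex_univ)
  have hP_cont : Continuous fun r => ∫ x, ⟪F x, u r x⟫_ℝ :=
    continuousOn_univ.1 (((Torus.isSmoothSpaceTimeOn_const hF univ).inner hu).continuousOn_integral convex_univ)
  -- `D² ≤ (t-s) A B` by the weighted AM–GM in space–time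
  have hD2 : ∀ lam : ℝ, 0 < lam → 2 * D ≤ lam * ((t - s) * A) + B / lam := by
    intro lam hl
    have hspace : ∀ r, 2 * ∫ x, ⟪F x, u r x⟫_ℝ ≤ lam * A + (∫ x, ‖u r x‖ ^ 2) / lam := by
      intro r
      have hur : Torus.IsSmooth (u r) := hu.isSmooth_slice (mem_univ r)
      have hint1 : Integrable (fun x => ⟪F x, u r x⟫_ℝ) := (hF.inner hur).integrable
      have hint2 : Integrable (fun x => lam * ‖F x‖ ^ 2 + ‖u r x‖ ^ 2 / lam) :=
        ((hF.norm_sq.integrable).const_mul lam).add (hur.norm_sq.integrable.div_const lam)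
      have hpt : ∀ x, 2 * ⟪F x, u r x⟫_ℝ ≤ lam * ‖F x‖ ^ 2 + ‖u r x‖ ^ 2 / lam := fun x =>
        (mul_le_mul_of_nonneg_left (real_inner_le_norm _ _) zero_le_two).trans (two_mul_le_weighted hl)
      calc 2 * ∫ x, ⟪F x, u r x⟫_ℝ = ∫ x, 2 * ⟪F x, u r x⟫_ℝ := (integral_const_mul _ _).symm
        _ ≤ ∫ x, (lam * ‖F x‖ ^ 2 + ‖u r x‖ ^ 2 / lam) := integral_mono (hint1.const_mul 2) hint2 hpt
        _ = lam * A + (∫ x, ‖u r x‖ ^ 2) / lam := by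
            rw [integral_add ((hF.norm_sq.integrable).const_mul lam) (hur.norm_sq.integrable.div_const lam),
              integral_const_mul, integral_div]
    have hi1 : IntervalIntegrable (fun r => ∫ x, ⟪F x, u r x⟫_ℝ) volume s t := hP_cont.intervalIntegrable _ _
    have hi2 : IntervalIntegrable (fun r => lam * A + (∫ x, ‖u r x‖ ^ 2) / lam) volume s t :=
      (continuous_const.add (he_cont.div_const lam)).intervalIntegrable _ _
    calc 2 * D = ∫ r in s..t, 2 * ∫ x, ⟪F x, u r x⟫_ℝ := (intervalIntegral.integral_const_mul _ _).symm
      _ ≤ ∫ r in s..t, (lam * A + (∫ x, ‖u r x‖ ^ 2) / lam) :=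
          intervalIntegral.integral_mono_on hst (hi1.const_mul 2) hi2 fun r _ => hspace r
      _ = lam * ((t - s) * A) + B / lam := by
          rw [intervalIntegral.integral_add intervalIntegrable_const ((he_cont.div_const lam).intervalIntegrable _ _),
            intervalIntegral.integral_const, intervalIntegral.integral_div]
          simp only [smul_eq_mul]
          ring
  rcases le_or_gt D 0 with hD0 | hDpos
  · have : 0 ≤ Real.sqrt A * Real.sqrt ((t - s) * B) := by positivity
    linarith
  · have hsq : D ^ 2 ≤ ((t - s) * A) * B :=
      sq_le_mul_of_forall_weighted (mul_nonneg (sub_nonneg.2 hst) hA) hB hDpos.le hD2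
    have hD_le : D ≤ Real.sqrt A * Real.sqrt ((t - s) * B) := by
      rw [← Real.sqrt_mul hA, ← Real.sqrt_sq hDpos.le]
      exact Real.sqrt_le_sqrt (by nlinarith [hsq])
    linarith

/-- Over a period some slice has energy at most the mean: `∃ s ∈ [0,τ], ∫‖u(s)‖² ≤ ⟨‖u‖²⟩`. -/
theorem exists_energy_le_mean (hu : Torus.IsSmoothSpaceTimeOn univ u) (hper : Function.Periodic u τ) (hτ : 0 < τ) :
    ∃ s ∈ Icc (0 : ℝ) τ, ∫ x, ‖u s x‖ ^ 2 ≤ meanEnergy u := by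
  have he_st : Torus.IsSmoothSpaceTimeOn univ (fun r x => ‖u r x‖ ^ 2) := by
    change ContDiffOn ℝ _ (fun z => ‖Torus.stLift u z‖ ^ 2) _
    exact hu.norm_sq ℝ
  have he_cont : Continuous fun r => ∫ x, ‖u r x‖ ^ 2 :=
    continuousOn_univ.1 (he_st.continuousOn_integral convex_univ)
  obtain ⟨s, hs, hmin⟩ := isCompact_Icc.exists_isMinOn (nonempty_Icc.2 hτ.le) he_cont.continuousOn
  refine ⟨s, hs, ?_⟩
  rw [meanEnergy_eq_period_mean hper hτ]
  -- `τ e(s) ≤ ∫₀^τ e`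
  have hmono : ∫ r in (0 : ℝ)..τ, (∫ x, ‖u s x‖ ^ 2) ≤ ∫ r in (0 : ℝ)..τ, ∫ x, ‖u r x‖ ^ 2 :=
    intervalIntegral.integral_mono_on hτ.le intervalIntegrable_const (he_cont.intervalIntegrable _ _)
      fun r hr => hmin hr
  rw [intervalIntegral.integral_const, sub_zero, smul_eq_mul] at hmono
  rw [le_inv_mul_iff₀ hτ]
  linarith

/-- SUP-ENERGY BOUND OF A PERIODIC ORBIT: `∫‖u(t)‖² ≤ ⟨‖u‖²⟩ + 2τ √(∫‖F‖²) √⟨‖u‖²⟩` for every `t`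
(steady force, `ν ≥ 0`). -/
theorem energy_le_of_periodic (h : Torus.IsClassicalNSSolutionOn univ ν (fun _ => F) u p) (hν : 0 ≤ ν)
    (hper : Function.Periodic u τ) (hτ : 0 < τ) (t : ℝ) :
    ∫ x, ‖u t x‖ ^ 2 ≤ meanEnergy u + 2 * τ * Real.sqrt (∫ x, ‖F x‖ ^ 2) * Real.sqrt (meanEnergy u) := by
  have hu := h.smooth_velocity
  obtain ⟨s, hs, hsE⟩ := exists_energy_le_mean hu hper hτ
  have hmE : 0 ≤ meanEnergy u := meanEnergy_nonneg' hper hτ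
  -- reduce `t` into the window `[s, s + τ]`
  obtain ⟨n, hn⟩ : ∃ n : ℤ, t - n • τ ∈ Icc s (s + τ) := by
    refine ⟨⌊(t - s) / τ⌋, ?_, ?_⟩
    · have h1 := Int.floor_le ((t - s) / τ)
      rw [zsmul_eq_mul]
      have : (⌊(t - s) / τ⌋ : ℝ) * τ ≤ t - s := by rwa [le_div_iff₀ hτ] at h1
      linarith
    · have h1 := Int.lt_floor_add_one ((t - s) / τ)
      rw [zsmul_eq_mul]
      have : t - s < ((⌊(t - s) / τ⌋ : ℝ) + 1) * τ := by rwa [div_lt_iff₀ hτ] at h1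
      linarith
  set t' := t - n • τ with ht'
  have hut : u t = u t' := by
    rw [ht']
    exact (hper.sub_zsmul_eq n).symm
  have hst : s ≤ t' := hn.1
  have ht's : t' - s ≤ τ := by linarith [hn.2]
  have hK := kineticEnergy_le_of_le h hν hst
  -- `∫_s^{t'} e ≤ ∫_s^{s+τ} e = τ ⟨‖u‖²⟩`
  have he_st : Torus.IsSmoothSpaceTimeOn univ (fun r x => ‖u r x‖ ^ 2) := by
    change ContDiffOn ℝ _ (fun z => ‖Torus.stLift u z‖ ^ 2) _
    exact hu.norm_sq ℝ
  have he_cont : Continuous fun r => ∫ x, ‖u r x‖ ^ 2 :=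
    continuousOn_univ.1 (he_st.continuousOn_integral convex_univ)
  have he_per : Function.Periodic (fun r => ∫ x, ‖u r x‖ ^ 2) τ := fun r => by simp only [hper r]
  have hB : ∫ r in s..t', ∫ x, ‖u r x‖ ^ 2 ≤ τ * meanEnergy u := by
    have h1 : ∫ r in s..t', ∫ x, ‖u r x‖ ^ 2 ≤ ∫ r in s..(s + τ), ∫ x, ‖u r x‖ ^ 2 := by
      rw [← intervalIntegral.integral_add_adjacent_intervals (a := s) (b := t') (c := s + τ)
        (he_cont.intervalIntegrable _ _) (he_cont.intervalIntegrable _ _)]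
      have : 0 ≤ ∫ r in t'..(s + τ), ∫ x, ‖u r x‖ ^ 2 :=
        intervalIntegral.integral_nonneg (by linarith) fun r _ => integral_nonneg fun _ => sq_nonneg _
      linarith
    rw [he_per.intervalIntegral_add_eq s 0, zero_add] at h1
    rw [meanEnergy_eq_period_mean hper hτ, ← mul_assoc, mul_inv_cancel₀ hτ.ne', one_mul]
    exact h1
  have hA : 0 ≤ ∫ x, ‖F x‖ ^ 2 := integral_nonneg fun _ => sq_nonneg _
  have hsqrt : Real.sqrt ((t' - s) * ∫ r in s..t', ∫ x, ‖u r x‖ ^ 2) ≤ τ * Real.sqrt (meanEnergy u) := by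
    have hB0 : 0 ≤ ∫ r in s..t', ∫ x, ‖u r x‖ ^ 2 :=
      intervalIntegral.integral_nonneg hst fun r _ => integral_nonneg fun _ => sq_nonneg _
    calc Real.sqrt ((t' - s) * ∫ r in s..t', ∫ x, ‖u r x‖ ^ 2) ≤ Real.sqrt (τ * (τ * meanEnergy u)) :=
          Real.sqrt_le_sqrt (mul_le_mul ht's hB hB0 hτ.le)
      _ = τ * Real.sqrt (meanEnergy u) := by
          rw [← mul_assoc, Real.sqrt_mul (mul_self_nonneg τ), Real.sqrt_mul_self hτ.le]
  rw [hut]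
  unfold Torus.kineticEnergy at hK
  have h2 : Real.sqrt (∫ x, ‖F x‖ ^ 2) * Real.sqrt ((t' - s) * ∫ r in s..t', ∫ x, ‖u r x‖ ^ 2) ≤
      Real.sqrt (∫ x, ‖F x‖ ^ 2) * (τ * Real.sqrt (meanEnergy u)) :=
    mul_le_mul_of_nonneg_left hsqrt (Real.sqrt_nonneg _)
  nlinarith [hK, h2, hsE]

variable {E ε : ℝ}

/-- PERIOD FLOOR FOR LOW-ENERGY LOUD ORBITS: a witness of `c ∈ LOUD_j(S,E,ε)` with period `τ` satisfies, for every
`N` with `S ⊆ B_N`, `ε - 4π²N²E/(j+1) ≤ 6πN√(#B_N) · W√W` with `W = E + 2τ‖f_c‖₂√E` — if `E√E` is small against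
`ε/(6πN√#B_N)` the period must be long. -/
theorem period_floor_of_loud (hsol : Torus.IsClassicalNSSolutionOn univ ν (fun _ => force S c) u p)
    {N : ℕ} (hS : S ⊆ Torus.freqBall N) (hν : 0 < ν) {j : ℕ} (hνj : ν < 1 / ((j : ℝ) + 1))
    (hper : Function.Periodic u τ) (hτ : 0 < τ) (hEu : meanEnergy u ≤ E) (hεu : ε ≤ meanDissipation ν u) :
    ε - 4 * Real.pi ^ 2 * (N : ℝ) ^ 2 * E / ((j : ℝ) + 1) ≤
      6 * Real.pi * (N : ℝ) * Real.sqrt ((Torus.freqBall (d := Fin 3) N).card) *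
        ((E + 2 * τ * Real.sqrt (∫ x, ‖force S c x‖ ^ 2) * Real.sqrt E) *
          Real.sqrt (E + 2 * τ * Real.sqrt (∫ x, ‖force S c x‖ ^ 2) * Real.sqrt E)) := by
  have hu := hsol.smooth_velocity
  have hcap := capacity_floor_of_loud hsol hS hν hνj hper hτ hEu hεu
  have hmE := meanEnergy_nonneg' hper hτ
  have hE : 0 ≤ E := hmE.trans hEu
  set W : ℝ := E + 2 * τ * Real.sqrt (∫ x, ‖force S c x‖ ^ 2) * Real.sqrt E with hW
  have hsup : ∀ t, ∫ x, ‖u t x‖ ^ 2 ≤ W := by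
    intro t
    refine (energy_le_of_periodic hsol hν.le hper hτ t).trans ?_
    have h1 : Real.sqrt (meanEnergy u) ≤ Real.sqrt E := Real.sqrt_le_sqrt hEu
    have h2 : 0 ≤ 2 * τ * Real.sqrt (∫ x, ‖force S c x‖ ^ 2) := by positivity
    nlinarith [mul_le_mul_of_nonneg_left h1 h2]
  have hW0 : 0 ≤ W := (integral_nonneg fun _ => sq_nonneg _).trans (hsup 0)
  -- pointwise: `√E_N ∫‖u‖² ≤ W √W`
  have hpt : ∀ t, Real.sqrt (lowEnergy N u t) * ∫ x, ‖u t x‖ ^ 2 ≤ W * Real.sqrt W := by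
    intro t
    have h1 := capacity_le_cubic hu N t
    have h2 : Real.sqrt (∫ x, ‖u t x‖ ^ 2) ≤ Real.sqrt W := Real.sqrt_le_sqrt (hsup t)
    have h3 : 0 ≤ ∫ x, ‖u t x‖ ^ 2 := integral_nonneg fun _ => sq_nonneg _
    calc Real.sqrt (lowEnergy N u t) * ∫ x, ‖u t x‖ ^ 2 ≤ Real.sqrt (∫ x, ‖u t x‖ ^ 2) * ∫ x, ‖u t x‖ ^ 2 := h1
      _ ≤ Real.sqrt W * W := mul_le_mul h2 (hsup t) h3 (Real.sqrt_nonneg _)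
      _ = W * Real.sqrt W := mul_comm _ _
  have hmono : ∫ t in (0 : ℝ)..τ, Real.sqrt (lowEnergy N u t) * ∫ x, ‖u t x‖ ^ 2 ≤ ∫ t in (0 : ℝ)..τ, W * Real.sqrt W :=
    intervalIntegral.integral_mono_on hτ.le ((continuous_capacity hu N).intervalIntegrable _ _)
      intervalIntegrable_const fun t _ => hpt t
  rw [intervalIntegral.integral_const, sub_zero, smul_eq_mul] at hmono
  have hmean : τ⁻¹ * ∫ t in (0 : ℝ)..τ, Real.sqrt (lowEnergy N u t) * ∫ x, ‖u t x‖ ^ 2 ≤ W * Real.sqrt W := by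
    rw [inv_mul_le_iff₀ hτ]
    exact hmono
  have hK : 0 ≤ 6 * Real.pi * (N : ℝ) * Real.sqrt ((Torus.freqBall (d := Fin 3) N).card) := by positivity
  exact hcap.trans (mul_le_mul_of_nonneg_left hmean hK)

end Period

/-! ## §18 (generation 3, cycle 2) The period floor on a WINDOW: low-energy windows need long-period witnesses

On a window `U` the force mass is paid by the energy, `∫‖f_c‖² ≤ Λ(c)E` (§6), so the sup-energy bound of §17 becomes
`sup_t∫‖u(t)‖² ≤ E(1 + 2τ√Λ(c))` for every witness of a loud point `c ∈ U ∩ LOUD_j`, and the period floor reads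
`ε - 4π²N²E/(j+1) ≤ 6πN√(#B_N) · W√W`, `W = E(1 + 2τ√Λ(c))` (`period_floor_on_window`): a window whose energy budget is
small against `(ε/(6πN√#B_N))^{2/3}` can only be served by orbits of period `τ ≳ ((ε/(6πN√#B_N))^{2/3}/E - 1)/(2√Λ(c))`,
uniformly over the window (`Λ(c) ≤ Λ₁(S)‖c‖` is bounded on bounded `U`). -/

section WindowPeriod

variable {S : Finset (Fin 3 → ℤ)} {E ε ν τ : ℝ} {c : ↥S → ℂ³} {u : ℝ → 𝕋³ → E³} {p : ℝ → 𝕋³ → ℝ}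

/-- PERIOD FLOOR ON A WINDOW: for a window `U` of the crux, a point `c ∈ U` and any witness `(ν, τ, u, p)` of
`c ∈ LOUD_j(S,E,ε)`: `ε - 4π²N²E/(j+1) ≤ 6πN√(#B_N)·W√W` with `W = E(1 + 2τ√Λ(c))`, `Λ(c) = gradBound S c`. -/
theorem period_floor_on_window {U : Set (↥S → ℂ³)} (hU : IsWindow S E ε U) (hcU : c ∈ U)
    (hsol : Torus.IsClassicalNSSolutionOn univ ν (fun _ => force S c) u p)
    {N : ℕ} (hS : S ⊆ Torus.freqBall N) (hν : 0 < ν) {j : ℕ} (hνj : ν < 1 / ((j : ℝ) + 1))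
    (hper : Function.Periodic u τ) (hτ : 0 < τ) (hEu : meanEnergy u ≤ E) (hεu : ε ≤ meanDissipation ν u) :
    ε - 4 * Real.pi ^ 2 * (N : ℝ) ^ 2 * E / ((j : ℝ) + 1) ≤
      6 * Real.pi * (N : ℝ) * Real.sqrt ((Torus.freqBall (d := Fin 3) N).card) *
        ((E * (1 + 2 * τ * Real.sqrt (gradBound S c))) * Real.sqrt (E * (1 + 2 * τ * Real.sqrt (gradBound S c)))) := by
  have h := period_floor_of_loud hsol hS hν hνj hper hτ hEu hεu
  have hmE := meanEnergy_nonneg' hper hτ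
  have hE : 0 ≤ E := hmE.trans hEu
  have hΛ := gradBound_nonneg S c
  have hF : ∫ x, ‖force S c x‖ ^ 2 ≤ gradBound S c * E := forceEnergy_le_of_window hU hcU
  -- `W = E + 2τ√(∫‖f_c‖²)√E ≤ E(1 + 2τ√Λ)`
  have hW : E + 2 * τ * Real.sqrt (∫ x, ‖force S c x‖ ^ 2) * Real.sqrt E ≤ E * (1 + 2 * τ * Real.sqrt (gradBound S c)) := by
    have h1 : Real.sqrt (∫ x, ‖force S c x‖ ^ 2) ≤ Real.sqrt (gradBound S c) * Real.sqrt E := by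
      rw [← Real.sqrt_mul hΛ]; exact Real.sqrt_le_sqrt hF
    have h2 : 0 ≤ 2 * τ := by positivity
    have h3 : Real.sqrt E * Real.sqrt E = E := Real.mul_self_sqrt hE
    calc E + 2 * τ * Real.sqrt (∫ x, ‖force S c x‖ ^ 2) * Real.sqrt E
        ≤ E + 2 * τ * (Real.sqrt (gradBound S c) * Real.sqrt E) * Real.sqrt E := by
          gcongr
      _ = E * (1 + 2 * τ * Real.sqrt (gradBound S c)) := by
          have : 2 * τ * (Real.sqrt (gradBound S c) * Real.sqrt E) * Real.sqrt E =
              2 * τ * Real.sqrt (gradBound S c) * (Real.sqrt E * Real.sqrt E) := by ring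
          rw [this, h3]; ring
  have hW0 : 0 ≤ E + 2 * τ * Real.sqrt (∫ x, ‖force S c x‖ ^ 2) * Real.sqrt E := by positivity
  have hmono : (E + 2 * τ * Real.sqrt (∫ x, ‖force S c x‖ ^ 2) * Real.sqrt E) *
      Real.sqrt (E + 2 * τ * Real.sqrt (∫ x, ‖force S c x‖ ^ 2) * Real.sqrt E) ≤
      (E * (1 + 2 * τ * Real.sqrt (gradBound S c))) * Real.sqrt (E * (1 + 2 * τ * Real.sqrt (gradBound S c))) :=
    mul_le_mul hW (Real.sqrt_le_sqrt hW) (Real.sqrt_nonneg _) (hW0.trans hW)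
  have hK : 0 ≤ 6 * Real.pi * (N : ℝ) * Real.sqrt ((Torus.freqBall (d := Fin 3) N).card) := by positivity
  exact h.trans (mul_le_mul_of_nonneg_left hmono hK)

end WindowPeriod

/-! ## VERDICT (end of generation 3, cycle 2)

NO KILL.  Every inequality valid for ALL periodic classical orbits that the energy / momentum / enstrophy-budget /
Fourier-slice calculus of this file can produce closes only against the budgets `E, ε` or against moments of the orbit
itself (`⟨‖u‖³⟩`, the period `τ`, the low-pass amplitude), never against the window `U`: the prover chooses the budgets
after the physics, so none of §3–§17 contradicts the crux.  The three exactly-solvable witness sub-families (linear §7,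
band-limited §9, generalised-Beltrami §13) and the planar analogue (§12) are certified EMPTY/FALSE, so a construction must
be genuinely nonlinear, multi-scale, three-dimensional, with a complete constant-flux cascade (§15), O(1) viscous force at
ever finer scales (§14), O(1) low-pass strain capacity (§16), and either O(1) energy or a long period (§17).  The kill
statement (§1) is a uniform-in-force local quietness theorem for steadily forced 3-D Navier–Stokes at small viscosity —
an open problem on which nothing is in print (LITERATURE above); numerically the witness class exists (UPOs with a K41
inertial range, van Veen–Vela-Martín–Kawahara 2019).  Cross-reference: the sibling adversary's VISCOSITY CEILING
`ν⟨ν‖∇u‖²⟩ ≤ ‖f_c‖₂²/(4π²)` (Cruxes/RobustLoudUpgrade/Disproof.lean §10 `viscosity_ceiling`, Poincaré + power identity)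
shows that a witness of `c ∈ LOUD_j(S,E,ε)` automatically has `ν ≤ ‖f_c‖₂²/(4π²ε) ≤ ∑‖c k‖²/(4π²ε)`: the level clause
only bites for `j + 1 > 4π²ε/∑‖c k‖²`. -/

end Summit.AnomalousDissipation.AnomalousDissipation.Cruxes.DenseLoudDesignerForces.Disproof

end
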